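import Mathlib
import Summits.CriticalPhenomena.Ising3DConformalLimit.Theorems.ModularQuarterTurnQuarterTurnAnchorsGeometry
import Literature.Probability.LatticeModels.InfraredBoundProofs
import HarnessLib

/-!
# `QuarterTurnAnchors`, II: locality and mirror symmetry of the corner energy; the corner transfer
# matrix is symmetric positive semidefinite (route `ModularQuarterTurn`, item stmt-CriticalPhenomena-6495)

`hQ` depends only on the spins of the quadrant; `hQ = aLow + aLow ∘ D` with `aLow` supported in the
lower closed half-quadrant `{x₁ ≤ x₀}` (Friedli–Velenik 2017, Example 10.9, for the quadrant); hence
Baxter's corner transfer matrix `ctm` is symmetric, and positive semidefinite by reflection positivity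
through the diagonal site plane (the tree's `sum_conj_reflect_mul_re_nonneg`, Friedli–Velenik 2017
Lemma 10.7; Fröhlich–Israel–Lieb–Simon 1978).  Also: nonnegative entries, hinge block structure, and
the contraction formula `∑_{s,s'} ctm s s' f s s' = ∑_κ quadWeight κ f (κ|_P) (κ|_{RP})`.
-/

namespace Summit.CriticalPhenomena.Ising3DConformalLimit.QuarterTurnCTM

open Literature.Probability.LatticeModels Finset
open scoped Matrix

section

variable (L : ℕ) (β : ℝ)

/-- A bond sum whose coefficients vanish unless all box endpoints of the bond satisfy a predicate `p`
depends only on the spins at the box sites satisfying `p` and on the spins outside the box.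
[folklore] -/
theorem sum_bond_congr_of_local (c : Site 3 → Site 3 → ℝ) (hc : ∀ x y, c x y = c y x)
    (p : Site 3 → Prop)
    (hcp : ∀ x y, c x y ≠ 0 → (x ∈ box 3 L → p x) ∧ (y ∈ box 3 L → p y))
    {ω ω' : SpinConfig (Site 3)} (hout : ∀ v, v ∉ box 3 L → ω v = ω' v)
    (hin : ∀ v ∈ box 3 L, p v → ω v = ω' v) :
    ∑ e ∈ edgesTouching (zdGraph 3) (box 3 L), Sym2.lift ⟨c, hc⟩ e * bondSpin ω e =
      ∑ e ∈ edgesTouching (zdGraph 3) (box 3 L), Sym2.lift ⟨c, hc⟩ e * bondSpin ω' e := by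
  refine Finset.sum_congr rfl fun e _ => ?_
  induction e using Sym2.ind with
  | _ x y =>
    simp only [Sym2.lift_mk]
    by_cases h0 : c x y = 0
    · rw [h0, zero_mul, zero_mul]
    · congr 1
      refine bondSpin_congr fun v hv => ?_
      have key : ∀ w, (w ∈ box 3 L → p w) → ω w = ω' w := fun w hw => by
        by_cases hb : w ∈ box 3 L
        · exact hin w hb (hw hb)
        · exact hout w hb
      rcases Sym2.mem_iff.1 hv with h | h <;> rw [h]
      exacts [key _ (hcp x y h0).1, key _ (hcp x y h0).2]

/-- **Locality of the quadrant energy**: `hQ L ω` depends only on the spins in the quadrant `quadQ L`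
and outside the box. [folklore] -/
theorem hQ_congr {ω ω' : SpinConfig (Site 3)} (hout : ∀ v, v ∉ box 3 L → ω v = ω' v)
    (hin : ∀ v ∈ quadQ L, ω v = ω' v) : hQ L ω = hQ L ω' := by
  refine sum_bond_congr_of_local L (qwt L) (qwt_comm L) (fun v => 0 ≤ v 0 ∧ 0 ≤ v 1) ?_ hout ?_
  · intro x y hxy
    exact of_qind_ne_zero L (left_ne_zero_of_mul hxy)
  · intro v hv hp
    exact hin v (mem_quadQ.2 ⟨hv, hp⟩)

/-- The quadrant indicator is mirror symmetric. [folklore] -/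
theorem qind_mirD (x y : Site 3) : qind L (mirD x) (mirD y) = qind L x y := by
  unfold qind
  refine if_congr ?_ rfl rfl
  simp only [mirD_mem_box_iff, mirD_apply_zero, mirD_apply_one]
  tauto

/-- `nrot` is mirror symmetric (the mirror conjugates `R` to `R⁻¹`, permuting the cycle). [folklore] -/
theorem nrot_mirD (x y : Site 3) : nrot L (mirD x) (mirD y) = nrot L x y := by
  unfold nrot
  simp only [rotR_iterate_mirD, qind_mirD, Fin.sum_univ_four, Fin.isValue, Fin.val_zero,
    Fin.val_one, Fin.val_two, show ((3 : Fin 4) : ℕ) = 3 from rfl, Function.iterate_zero, id_eq,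
    Function.iterate_one, rotRinv_iterate_three, rotR_iterate_three, rotR_iterate_two]
  rw [show rotRinv^[2] x = rotR (rotR x) from rotRinv_rotRinv x,
    show rotRinv^[2] y = rotR (rotR y) from rotRinv_rotRinv y]
  ring

/-- The quadrant bond weight is mirror symmetric. [folklore] -/
theorem qwt_mirD (x y : Site 3) : qwt L (mirD x) (mirD y) = qwt L x y := by
  unfold qwt; rw [qind_mirD, nrot_mirD]

/-- The shares of a bond and of its mirror image add up to one. [folklore] -/
theorem loRho_add_loRho_mirD (x y : Site 3) : loRho L x y + loRho L (mirD x) (mirD y) = 1 := by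
  unfold loRho
  simp only [mirD_mem_box_iff, mirD_apply_zero, mirD_apply_one]
  split_ifs <;> norm_num

/-- **Diagonal decomposition of the quadrant energy**: `hQ ω = aLow ω + aLow (ω ∘ D)` — the quadrant
energy is the lower-half energy plus its mirror image (Friedli–Velenik 2017, Example 10.9, for the
quadrant instead of the torus). [folklore] -/
theorem hQ_eq_aLow_add_aLow_mirD (ω : SpinConfig (Site 3)) :
    hQ L ω = aLow L ω + aLow L (ω ∘ mirD) := by
  unfold hQ aLow
  -- reindex the mirrored sum by the mirror
  have step : ∑ e ∈ edgesTouching (zdGraph 3) (box 3 L),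
      Sym2.lift ⟨fun x y => qwt L x y * loRho L x y,
        fun x y => by dsimp only; rw [qwt_comm, loRho_comm]⟩ e * bondSpin (ω ∘ mirD) e =
      ∑ e ∈ edgesTouching (zdGraph 3) (box 3 L),
      Sym2.lift ⟨fun x y => qwt L x y * loRho L (mirD x) (mirD y),
        fun x y => by dsimp only; rw [qwt_comm, loRho_comm]⟩ e * bondSpin ω e := by
    rw [← sum_edgesTouching_comp_mirD L (fun e => Sym2.lift ⟨fun x y => qwt L x y * loRho L (mirD x) (mirD y),
        fun x y => by dsimp only; rw [qwt_comm, loRho_comm]⟩ e * bondSpin ω e)]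
    refine Finset.sum_congr rfl fun e _ => ?_
    induction e using Sym2.ind with
    | _ x y =>
      rw [bondSpin_comp_fun]
      simp only [Sym2.map_mk, Sym2.lift_mk, mirD_mirD, qwt_mirD]
  rw [step, ← Finset.sum_add_distrib]
  refine Finset.sum_congr rfl fun e _ => ?_
  induction e using Sym2.ind with
  | _ x y =>
    simp only [Sym2.lift_mk, quadCoeff_mk]
    rw [← add_mul, ← mul_add, loRho_add_loRho_mirD, mul_one]

/-- **Locality of the lower-half energy**: `aLow L ω` depends only on the spins in the lower closed
half-quadrant `{v ∈ quadQ L | v₁ ≤ v₀}` and outside the box. [folklore] -/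
theorem aLow_congr {ω ω' : SpinConfig (Site 3)} (hout : ∀ v, v ∉ box 3 L → ω v = ω' v)
    (hin : ∀ v ∈ quadQ L, v 1 ≤ v 0 → ω v = ω' v) : aLow L ω = aLow L ω' := by
  unfold aLow
  refine Finset.sum_congr rfl fun e he => ?_
  have hadj : e ∈ (zdGraph 3).edgeSet := (mem_edgesTouching_iff.1 he).1
  induction e using Sym2.ind with
  | _ x y =>
    rw [SimpleGraph.mem_edgeSet] at hadj
    simp only [Sym2.lift_mk]
    by_cases h0 : qwt L x y * loRho L x y = 0
    · rw [h0, zero_mul, zero_mul]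
    · congr 1
      have hq : qind L x y ≠ 0 := left_ne_zero_of_mul (left_ne_zero_of_mul h0)
      obtain ⟨hxq, hyq⟩ := of_qind_ne_zero L hq
      have hρ : loRho L x y ≠ 0 := right_ne_zero_of_mul h0
      -- a bond with nonzero share lies weakly below the diagonal
      have hlow : (x ∈ box 3 L → x 1 ≤ x 0) ∧ (y ∈ box 3 L → y 1 ≤ y 0) := by
        by_contra hc
        rcases adj_low_or_up hadj with hl | hu
        · exact hc ⟨fun _ => hl.1, fun _ => hl.2⟩
        · apply hρ
          unfold loRho
          rw [if_neg hc, if_pos ⟨fun _ => hu.1, fun _ => hu.2⟩]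
          norm_num
      refine bondSpin_congr fun v hv => ?_
      have key : ∀ w, (w ∈ box 3 L → 0 ≤ w 0 ∧ 0 ≤ w 1) → (w ∈ box 3 L → w 1 ≤ w 0) → ω w = ω' w := by
        intro w hw hw'
        by_cases hb : w ∈ box 3 L
        · exact hin w (mem_quadQ.2 ⟨hb, hw hb⟩) (hw' hb)
        · exact hout w hb
      rcases Sym2.mem_iff.1 hv with h | h <;> rw [h]
      exacts [key _ hxq hlow.1, key _ hyq hlow.2]

/-- Corner weights are positive. [folklore] -/
theorem quadWeight_pos (κ : ↥(quadQ L) → ℤˣ) : 0 < quadWeight L β κ := Real.exp_pos _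

/-- The corner transfer matrix has nonnegative entries. [folklore] -/
theorem ctm_nonneg (s s' : ↥(wallP L) → ℤˣ) : 0 ≤ ctm L β s s' := by
  rw [ctm_apply]
  exact Finset.sum_nonneg fun κ _ => by split_ifs <;> [exact (quadWeight_pos L β κ).le; exact le_rfl]

/-- The corner transfer matrix is block diagonal in the hinge configuration: a nonzero entry forces the
two wall configurations to agree on the hinge `x₀ = 0` (which the quarter turn fixes). [folklore] -/
theorem hinge_eq_of_ctm_ne_zero {s s' : ↥(wallP L) → ℤˣ} (h : ctm L β s s' ≠ 0) :
    ∀ x : ↥(wallP L), x.1 0 = 0 → s x = s' x := by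
  intro x hx0
  obtain ⟨κ, -, hκ⟩ := Finset.exists_ne_zero_of_sum_ne_zero h
  have hc : resA L κ = s ∧ resB L κ = s' := by by_contra hc; exact hκ (if_neg hc)
  rw [← hc.1, ← hc.2, resA, resB]
  congr 1
  apply Subtype.ext
  have hx1 : x.1 1 = 0 := (mem_wallP.1 x.2).2.1
  rw [site_ext_iff]
  simp only [rotR_apply_zero, rotR_apply_one, rotR_apply_two, and_true]
  omega

/-- `mirQ` is an involution. [folklore] -/
theorem mirQ_mirQ (x : ↥(quadQ L)) : mirQ L (mirQ L x) = x := Subtype.ext (mirD_mirD x.1)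

/-- `mirQ` is an involution. [folklore] -/
theorem mirQ_involutive : Function.Involutive (mirQ L) := mirQ_mirQ L

/-- Gluing commutes with the mirror. [folklore] -/
theorem glue_comp_mirQ (κ : ↥(quadQ L) → ℤˣ) :
    glue (quadQ L) (κ ∘ mirQ L) .plus = glue (quadQ L) κ .plus ∘ mirD :=
  glue_comp_volEquiv mirEquiv _ .plus (fun _ => rfl) κ

/-- Mirroring a quadrant configuration swaps its two wall restrictions: `(κ ∘ D)|_P = κ|_{RP} ∘ R`. [folklore] -/
theorem resA_comp_mirQ (κ : ↥(quadQ L) → ℤˣ) : resA L (κ ∘ mirQ L) = resB L κ := by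
  funext x
  simp only [resA, resB, Function.comp_apply]
  congr 1
  exact Subtype.ext ((rotR_eq_mirD_of_mem_wallP x.2).symm)

/-- Mirroring a quadrant configuration swaps its two wall restrictions: `(κ ∘ D)|_{RP} ∘ R = κ|_P`. [folklore] -/
theorem resB_comp_mirQ (κ : ↥(quadQ L) → ℤˣ) : resB L (κ ∘ mirQ L) = resA L κ := by
  funext x
  simp only [resA, resB, Function.comp_apply]
  congr 1
  apply Subtype.ext
  have hx1 : x.1 1 = 0 := (mem_wallP.1 x.2).2.1
  show mirD (rotR x.1) = x.1
  rw [site_ext_iff]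
  simp only [mirD_apply_zero, mirD_apply_one, mirD_apply_two, rotR_apply_zero, rotR_apply_one,
    rotR_apply_two, and_true, true_and]
  omega

/-- The corner weight factorises over the two mirror halves of the quadrant:
`quadWeight κ = exp (β aLow (glue κ)) · exp (β aLow (glue (κ ∘ D)))`. [folklore] -/
theorem quadWeight_eq_mul (κ : ↥(quadQ L) → ℤˣ) : quadWeight L β κ =
    Real.exp (β * aLow L (glue (quadQ L) κ .plus)) *
      Real.exp (β * aLow L (glue (quadQ L) (κ ∘ mirQ L) .plus)) := by
  rw [quadWeight, hQ_eq_aLow_add_aLow_mirD, glue_comp_mirQ, mul_add, Real.exp_add]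

/-- Precomposition with the mirror twice is the identity. [folklore] -/
theorem comp_mirQ_comp_mirQ (κ : ↥(quadQ L) → ℤˣ) : (κ ∘ mirQ L) ∘ mirQ L = κ := by
  rw [Function.comp_assoc, (mirQ_involutive L).comp_self, Function.comp_id]

/-- Precomposition with the mirror is an involution of the quadrant configurations. [folklore] -/
theorem comp_mirQ_involutive :
    Function.Involutive (fun κ : ↥(quadQ L) → ℤˣ => κ ∘ ⇑(mirQ L)) := comp_mirQ_comp_mirQ L

/-- The corner weight is mirror symmetric. [folklore] -/
theorem quadWeight_comp_mirQ (κ : ↥(quadQ L) → ℤˣ) :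
    quadWeight L β (κ ∘ mirQ L) = quadWeight L β κ := by
  rw [quadWeight_eq_mul, quadWeight_eq_mul, comp_mirQ_comp_mirQ, mul_comm]

/-- **The corner transfer matrix is symmetric** (reflection in the diagonal plane `x₀ = x₁` swaps the two
walls and preserves the corner weight). [folklore] -/
theorem ctm_symm (s s' : ↥(wallP L) → ℤˣ) : ctm L β s' s = ctm L β s s' := by
  rw [ctm_apply, ctm_apply]
  refine Fintype.sum_equiv ((comp_mirQ_involutive L).toPerm _)
    (fun κ => if resA L κ = s' ∧ resB L κ = s then quadWeight L β κ else 0)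
    (fun κ => if resA L κ = s ∧ resB L κ = s' then quadWeight L β κ else 0) (fun κ => ?_)
  rw [Function.Involutive.coe_toPerm, resA_comp_mirQ, resB_comp_mirQ, quadWeight_comp_mirQ]
  exact if_congr ⟨fun h => ⟨h.2, h.1⟩, fun h => ⟨h.2, h.1⟩⟩ rfl rfl

/-- The corner transfer matrix is Hermitian (real symmetric). [folklore] -/
theorem ctm_isHermitian : (ctm L β).IsHermitian :=
  Matrix.IsHermitian.ext fun s s' => by rw [star_trivial, ctm_symm]

/-- Contraction of the two wall indices of the corner transfer matrix against a kernel `f`: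
`∑_{s,s'} ctm s s' · f s s' = ∑_κ quadWeight κ · f (κ|_P) (κ|_{RP})`. [folklore] -/
theorem sum_sum_ctm_mul (f : (↥(wallP L) → ℤˣ) → (↥(wallP L) → ℤˣ) → ℝ) :
    ∑ s, ∑ s', ctm L β s s' * f s s' = ∑ κ : ↥(quadQ L) → ℤˣ, quadWeight L β κ * f (resA L κ) (resB L κ) := by
  symm
  rw [← Finset.sum_fiberwise Finset.univ (resA L) _]
  refine Finset.sum_congr rfl fun s _ => ?_
  rw [← Finset.sum_fiberwise _ (resB L) _]
  refine Finset.sum_congr rfl fun s' _ => ?_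
  rw [Finset.filter_filter, ctm_apply, Finset.sum_mul]
  simp_rw [ite_mul, zero_mul]
  rw [← Finset.sum_filter]
  refine Finset.sum_congr rfl fun κ hκ => ?_
  obtain ⟨h1, h2⟩ := (Finset.mem_filter.1 hκ).2
  rw [h1, h2]

open scoped ComplexConjugate in
/-- **The corner transfer matrix is positive semidefinite.** The quadratic form
`∑_{s,s'} v_s ctm_{s s'} v_{s'}` equals `∑_κ G(κ ∘ D) G(κ)` with `G κ = v(κ|_P) exp (β aLow κ)` depending
only on the lower closed half-quadrant `{x₁ ≤ x₀}`, and such reflection sums are nonnegative by the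
tree's reflection positivity through sites (`sum_conj_reflect_mul_re_nonneg`: Friedli–Velenik 2017,
Lemma 10.7; Fröhlich–Israel–Lieb–Simon 1978 for diagonal site planes). [folklore] -/
theorem ctm_posSemidef : (ctm L β).PosSemidef := by
  refine Matrix.PosSemidef.of_dotProduct_mulVec_nonneg (ctm_isHermitian L β) fun v => ?_
  -- the quadratic form as a sum over quadrant configurations
  have hq : star v ⬝ᵥ (ctm L β *ᵥ v) =
      ∑ κ : ↥(quadQ L) → ℤˣ, quadWeight L β κ * (v (resA L κ) * v (resB L κ)) := by
    rw [star_trivial, ← sum_sum_ctm_mul L β (fun s s' => v s * v s')]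
    simp only [dotProduct, Matrix.mulVec, Finset.mul_sum]
    exact Finset.sum_congr rfl fun s _ => Finset.sum_congr rfl fun s' _ => by ring
  rw [hq]
  -- the half-quadrant observable
  set G : (↥(quadQ L) → ℤˣ) → ℝ :=
    fun κ => v (resA L κ) * Real.exp (β * aLow L (glue (quadQ L) κ .plus)) with hG
  have hsum : ∑ κ : ↥(quadQ L) → ℤˣ, quadWeight L β κ * (v (resA L κ) * v (resB L κ)) =
      ∑ κ, G (κ ∘ mirQ L) * G κ := by
    refine Finset.sum_congr rfl fun κ _ => ?_
    simp only [hG, quadWeight_eq_mul, resA_comp_mirQ]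
    ring
  rw [hsum]
  -- reflection positivity through the diagonal site plane of the quadrant
  have H1 : ∀ x : ↥(quadQ L), x ∈ {x : ↥(quadQ L) | x.1 1 ≤ x.1 0} ∨
      mirQ L x ∈ {x : ↥(quadQ L) | x.1 1 ≤ x.1 0} := by
    intro x
    rcases le_total (x.1 1) (x.1 0) with h | h
    · exact Or.inl h
    · right
      show (mirD x.1) 1 ≤ (mirD x.1) 0
      simpa using h
  have H2 : ∀ x ∈ {x : ↥(quadQ L) | x.1 1 ≤ x.1 0}, mirQ L x ∈ {x : ↥(quadQ L) | x.1 1 ≤ x.1 0} →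
      mirQ L x = x := by
    intro x h1 h2
    apply Subtype.ext
    change x.1 1 ≤ x.1 0 at h1
    change (mirD x.1) 1 ≤ (mirD x.1) 0 at h2
    simp only [mirD_apply_zero, mirD_apply_one] at h2
    show mirD x.1 = x.1
    rw [site_ext_iff]
    simp only [mirD_apply_zero, mirD_apply_one, mirD_apply_two, and_true]
    omega
  have hGloc : ∀ κ κ' : ↥(quadQ L) → ℤˣ, (∀ x ∈ {x : ↥(quadQ L) | x.1 1 ≤ x.1 0}, κ x = κ' x) →
      (G κ : ℂ) = (G κ' : ℂ) := by
    intro κ κ' h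
    simp only [hG]
    have hA : resA L κ = resA L κ' := by
      funext x
      have hx := mem_wallP.1 x.2
      exact h ⟨x.1, wallP_subset_quadQ L x.2⟩ (show x.1 1 ≤ x.1 0 by omega)
    have hL : aLow L (glue (quadQ L) κ .plus) = aLow L (glue (quadQ L) κ' .plus) := by
      refine aLow_congr L (fun w hw => ?_) (fun w hw hle => ?_)
      · have hwQ : w ∉ quadQ L := fun h' => hw (quadQ_subset_box L h')
        rw [glue_apply_of_notMem _ _ _ hwQ, glue_apply_of_notMem _ _ _ hwQ]
      · rw [glue_apply_of_mem _ _ _ hw, glue_apply_of_mem _ _ _ hw]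
        exact h ⟨w, hw⟩ hle
    rw [hA, hL]
  have key := sum_conj_reflect_mul_re_nonneg (mirQ L) (mirQ_involutive L)
    {x : ↥(quadQ L) | x.1 1 ≤ x.1 0} H1 H2 (fun κ => (G κ : ℂ)) hGloc
  have hre : (∑ κ : ↥(quadQ L) → ℤˣ, conj ((G (κ ∘ mirQ L) : ℂ)) * (G κ : ℂ)).re =
      ∑ κ, G (κ ∘ mirQ L) * G κ := by
    rw [Complex.re_sum]
    refine Finset.sum_congr rfl fun κ _ => ?_
    rw [Complex.conj_ofReal, ← Complex.ofReal_mul, Complex.ofReal_re]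
  rwa [hre] at key

end

end Summit.CriticalPhenomena.Ising3DConformalLimit.QuarterTurnCTM
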